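import Summits.CriticalPhenomena.PercolationContinuityZ3.Theorems.SahiMasterFamilyCBarRefutationPrelim
import Summits.CriticalPhenomena.PercolationContinuityZ3.Theorems.SahiMasterFamilyPrincipalCapLeSix

/-!
# The root-summed criterion (C̄) is FALSE: `¬ RootSummed.CBar 11` — the pinned-block pair on 12 points has `cbarSlack (1/2) = −9!/8 < 0`

Unit `prim-masterthm-p4` (gen 27; crux anchor stmt-CriticalPhenomena-4575, helper work; memo
`run/shared/lean/prim/prim-masterthm/prim-masterthm-p4/P4-GEN27-REPORT.md` §3, note of record CBAR-REFUTATION.md).  Companion of `…CBar`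
(typed conjecture `RootSummed.CBar n`: for every pair of union-closed families `∋ univ` on `Fin (n+1)` the root-summed slack
`cbarSlack = Σ_z [W^{(z)} + Σ_{B ∋ z, T∖B in neither family} (|B|−1)!·γ_B·P_{T∖B}]` is Bernstein-positive of degree `n+1`; its docstring records
"0 failures" on ≤ 5 points exhaustively, ≈ 2·10⁹ pairs on 5 points, random/adversarial pairs on 6–8 points and Young-invariant pairs to 16 points) and of
`…CBarRefutationPrelim` (evaluation tools; the pair `famU`, `famV` and its defects at `½`).

**THEOREM `not_CBar_eleven : ¬ RootSummed.CBar 11`.**  THE PAIR (`famU`, `famV`, the PINNED-BLOCK pair PB(10)): `T = Fin 12 = B ⊔ {x, y}`, `B = {0,…,9}`,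
pin `p = 0`, `x = 10`, `y = 11`; NON-members `2^T ∖ 𝒰 = {{y}, {x,y}}`, `2^T ∖ 𝒱 = {{x}, {x,y}} ∪ {S ⊆ B : p ∈ S}`.  Both families are union-closed and
contain `univ`; the only set in neither family is the crossing pair `{x,y}` (`P_{xy} = −w(1−w)`).  At `w = ½` (all defects `γ_S = ½[S ∉ 𝒰] + ½[S ∉ 𝒱]`):
* cap terms (`capW (rooted z …) = A(T∖z)`, `…Prelim.capW_rooted_eq_badOn`): a permutation of `T∖z` with all cycle defects `≠ 0` must make `B∖z` (which
  can only be covered by sets through the pin) ONE cycle, so `W^{(p)} = 0`, `W^{(z)} = 8!·½·(¼ + 1)` for the nine `z ∈ B∖p`, `W^{(x)} = W^{(y)} = 9!·¼`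
  (`W_pin`, `W_block`, `W_x`, `W_y`, via the block expansion inside `T∖z` at the pin and the vanishing lemma);
* bad blocks: the rooted pair at `z` has a bad block iff `z ∈ B`, namely the relabelled `B`, contributing `9!·½·P_{xy}(½) = −9!/8` (`badBlocks_rooted`,
  `blockTerm_rooted`, `PrincipalCapBeta.phiSet_two`);
* hence **`cbarSlack famU famV (1/2) = 9·(25200) + 2·(90720) − 10·(45360) = −45360 = −9!/8`** (`cbarSlack_half`), whereas `CBar 11` would make it the value
  at `½` of a nonnegative combination of Bernstein monomials (`BPos.nonneg`).
PAPER CLOSED FORM (P4-GEN27-REPORT §3, exact engine = formula for 5 ≤ k ≤ 12): for the pinned-block pair PB(b) on `b+2` points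
`cbarSlack(w) = (b−1)!·(1−w)·(2 − (b−1)·w(1−w))`; `b = 9`: `2·8!(1−w)(1−2w)²` (zero at ½, so not Bernstein-positive of ANY degree: `CBar 10` fails too);
`b ≥ 10`: negative near `½`; `b ≤ 8`: Bernstein-positive (whence the earlier census evidence).  MECHANISM: root-summation weighs a block by `|B|·(|B|−1)! = |B|!`;
one large block outside `𝒱` facing the crossing pair outweighs all cap mass, which is tied to the `(|B|−1)!` cyclic orders of `B`.  What is NOT refuted:
conjecture (B) (here `P_T = 9!(1−w)`, and the pair is half-rootable, `…HalfRootable`), gen 26's ∃-root `SideExpansion.SideCrit` (side `𝒰` passes at every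
root), (TM).  With (C̄) die its memo forms (C̄′) and scheme S1 ((1,1) nodes); `RootSummed.bpos_mix_of_CBar_of_oneSided` keeps an unsatisfiable hypothesis
for `n ≥ 10`.  HONEST FRAMING: a refutation of a typed criterion; (B), `UCHullNonneg k` (k ≥ 8), Sahi's `C_k` and the master theorem remain OPEN.
Axioms standard. [this work]
-/

noncomputable section

open scoped Classical

namespace Summit.CriticalPhenomena.PercolationContinuityZ3.Theorems

namespace CBarRefutation

open Finset Function Equiv
open Literature.Combinatorics.Sahi2008
open Literature.Combinatorics.Sahi2008.CycleForm
open PrincipalCapBeta (phiSet realF realW)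
open BernsteinPos UCBernsteinNested RootSummed ComplementForm

/-! ### The cap terms `W^{(z)}(½)` -/

/-- Moments of the model at `½` are the mixture values. [this work] -/
theorem ex_half (B : Finset (Fin 12)) :
    ex (realW (mix famU famV (1 / 2))) (fun a => ∏ j ∈ B, realF j a) = mix famU famV (1 / 2) B := ex_realW_prod_fun' _ B

/-- `W^{(p)}(½) = 0`: without the pin no point of the block can be covered. [this work] -/
theorem W_pin : badOn (realW (mix famU famV (1 / 2))) (realF : Fin 12 → Finset (Fin 12) → ℝ) (univ.erase pp) = 0 := by
  have h1 : (1 : Fin 12) ∈ Bset := by decide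
  refine badOn_eq_zero_of_forall _ _ (q := (1 : Fin 12)) (by decide) fun B hB h1B => ?_
  rw [ex_half]
  exact mix_half_of_mem_Bset h1 h1B fun ⟨hp, _⟩ => by have := mem_erase.1 (hB hp); exact this.1 rfl

/-- The generic cap evaluation: inside `R ∋ p`, if the pinned blocks `S ⊆ R` with `p ∈ S ⊆ B` are exactly the subsets of `S₀ ∋ p` (`S₀ = R ∩ B`) then
`A(R) = (|S₀|−1)!·½·A(R ∖ S₀)`. [this work] -/
theorem badOn_pin (R S₀ : Finset (Fin 12)) (hpR : pp ∈ R) (hS₀ : S₀ = R ∩ Bset) :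
    badOn (realW (mix famU famV (1 / 2))) (realF : Fin 12 → Finset (Fin 12) → ℝ) R =
      ((S₀.card - 1).factorial : ℝ) * ((1 / 2) * badOn (realW (mix famU famV (1 / 2))) (realF : Fin 12 → Finset (Fin 12) → ℝ) (R \ S₀)) := by
  have hpS₀ : pp ∈ S₀ := by rw [hS₀]; exact mem_inter.2 ⟨hpR, pp_mem_Bset⟩
  have hS₀R : S₀ ⊆ R := by rw [hS₀]; exact inter_subset_left
  have hS₀B : S₀ ⊆ Bset := by rw [hS₀]; exact inter_subset_right
  rw [badOn_eq_sum_blocks _ _ hpR, sum_eq_single_of_mem S₀ (mem_filter.2 ⟨mem_powerset.2 hS₀R, hpS₀⟩)]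
  · rw [ex_half, mix_half_pset hpS₀ hS₀B]; norm_num
  · intro B hB hne
    obtain ⟨hBR, hpB⟩ := mem_filter.1 hB
    have hBR' : B ⊆ R := mem_powerset.1 hBR
    by_cases hBB : B ⊆ Bset
    · -- `B ⊊ S₀`: a point of `S₀ ∖ B` is left over and kills the complementary factor
      have hBS₀ : B ⊆ S₀ := by rw [hS₀]; exact subset_inter hBR' hBB
      obtain ⟨q, hqS₀, hqB⟩ : ∃ q ∈ S₀, q ∉ B := not_subset.1 fun h => hne (subset_antisymm hBS₀ h)
      have hz : badOn (realW (mix famU famV (1 / 2))) (realF : Fin 12 → Finset (Fin 12) → ℝ) (R \ B) = 0 := by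
        refine badOn_eq_zero_of_forall _ _ (q := q) (mem_sdiff.2 ⟨hS₀R hqS₀, hqB⟩) fun B' hB' hqB' => ?_
        rw [ex_half]
        exact mix_half_of_mem_Bset (hS₀B hqS₀) hqB' fun ⟨hp', _⟩ => (mem_sdiff.1 (hB' hp')).2 hpB
      rw [hz]; ring
    · rw [ex_half, mix_half_of_mem_Bset pp_mem_Bset hpB (fun h => hBB h.2)]; ring

/-- `W^{(x)}(½) = 9!·¼`. [this work] -/
theorem W_x : badOn (realW (mix famU famV (1 / 2))) (realF : Fin 12 → Finset (Fin 12) → ℝ) (univ.erase xx) = (Nat.factorial 9 : ℝ) * (1 / 4) := by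
  rw [badOn_pin (univ.erase xx) Bset (by decide) (by decide)]
  have h1 : univ.erase xx \ Bset = {yy} := by decide
  have h2 : Bset.card = 10 := by decide
  rw [h1, badOn_singleton, ex_half, mix_half_y, h2]
  norm_num

/-- `W^{(y)}(½) = 9!·¼`. [this work] -/
theorem W_y : badOn (realW (mix famU famV (1 / 2))) (realF : Fin 12 → Finset (Fin 12) → ℝ) (univ.erase yy) = (Nat.factorial 9 : ℝ) * (1 / 4) := by
  rw [badOn_pin (univ.erase yy) Bset (by decide) (by decide)]
  have h1 : univ.erase yy \ Bset = {xx} := by decide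
  have h2 : Bset.card = 10 := by decide
  rw [h1, badOn_singleton, ex_half, mix_half_x, h2]
  norm_num

/-- `W^{(z)}(½) = 8!·½·(¼ + 1)` for the nine `z ∈ B ∖ {p}`. [this work] -/
theorem W_block {z : Fin 12} (hz : z ∈ Bset) (hzp : z ≠ pp) :
    badOn (realW (mix famU famV (1 / 2))) (realF : Fin 12 → Finset (Fin 12) → ℝ) (univ.erase z) = (Nat.factorial 8 : ℝ) * (5 / 8) := by
  obtain ⟨hzx, hzy⟩ := (mem_Bset z).1 hz
  have hS : Bset.erase z = univ.erase z ∩ Bset := by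
    ext q; simp only [mem_erase, mem_inter, mem_univ, and_true]
  rw [badOn_pin (univ.erase z) (Bset.erase z) (mem_erase.2 ⟨hzp.symm, mem_univ _⟩) hS]
  have h1 : univ.erase z \ Bset.erase z = {xx, yy} := by
    ext q
    rw [mem_sdiff, mem_erase, mem_erase, mem_Bset, mem_insert, mem_singleton]
    constructor
    · rintro ⟨⟨hqz, _⟩, h⟩
      by_cases hqx : q = xx
      · exact Or.inl hqx
      · right; by_contra hqy; exact h ⟨hqz, hqx, hqy⟩
    · rintro (rfl | rfl)
      · exact ⟨⟨fun h => hzx h.symm, mem_univ _⟩, fun h => h.2.1 rfl⟩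
      · exact ⟨⟨fun h => hzy h.symm, mem_univ _⟩, fun h => h.2.2 rfl⟩
  have h2 : (Bset.erase z).card = 9 := by rw [card_erase_of_mem hz]; decide
  rw [h1, badOn_pair _ _ xx_ne_yy, ex_half, ex_half, ex_half, mix_half_x, mix_half_y, mix_half_xy, h2]
  norm_num

/-! ### The bad blocks of the rooted pairs -/

/-- The relabelling transposition `(z y)`. [this work] -/
abbrev sw (z : Fin 12) : Fin 12 ↪ Fin 12 := (Equiv.swap z (Fin.last 11)).toEmbedding

/-- Unfolding the relabelling. [this work] -/
theorem sw_apply (z q : Fin 12) : sw z q = Equiv.swap z yy q := rfl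

/-- A set is doubly bad for the pair rooted at `z` iff its relabelling is the crossing pair. [this work] -/
theorem doublyBad_rooted_iff (z : Fin 12) (S : Finset (Fin 12)) :
    (S ∉ rooted z famU ∧ S ∉ rooted z famV) ↔ S = ({xx, yy} : Finset (Fin 12)).map (sw z) := by
  rw [mem_rooted, mem_rooted, notMem_both_iff]
  change S.map (sw z) = {xx, yy} ↔ S = ({xx, yy} : Finset (Fin 12)).map (sw z)
  have hinv : ∀ A : Finset (Fin 12), (A.map (sw z)).map (sw z) = A := by
    intro A; rw [map_map]
    have : (sw z).trans (sw z) = Function.Embedding.refl _ := by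
      apply Function.Embedding.ext; intro q
      show Equiv.swap z yy (Equiv.swap z yy q) = q
      exact Equiv.swap_apply_self _ _ _
    rw [this]; exact map_refl
  constructor
  · intro h; rw [← h, hinv]
  · intro h; rw [h, hinv]

/-- For a root in the block, the rooted pair has exactly one bad block: the complement of `{x, z}`. [this work] -/
theorem badBlocks_rooted_of_mem {z : Fin 12} (hz : z ∈ Bset) :
    badBlocks (rooted z famU) (rooted z famV) = {univ \ {xx, z}} := by
  obtain ⟨hzx, hzy⟩ := (mem_Bset z).1 hz
  have hmap : ({xx, yy} : Finset (Fin 12)).map (sw z) = {xx, z} := by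
    rw [map_insert, map_singleton, sw_apply, sw_apply, Equiv.swap_apply_of_ne_of_ne hzx.symm xx_ne_yy, Equiv.swap_apply_right]
  ext B'
  unfold badBlocks
  rw [mem_filter, doublyBad_rooted_iff, hmap, mem_singleton]
  simp only [mem_univ, true_and]
  constructor
  · rintro ⟨_, _, h⟩
    rw [← compl_eq_univ_sdiff] at h ⊢
    rw [← h, compl_compl]
  · rintro rfl
    refine ⟨?_, ?_, ?_⟩
    · rw [mem_sdiff]; refine ⟨mem_univ _, ?_⟩
      show Fin.last 11 ∉ ({xx, z} : Finset (Fin 12))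
      simp only [mem_insert, mem_singleton, not_or]
      exact ⟨fun h => xx_ne_yy h.symm, fun h => hzy h.symm⟩
    · intro h
      have hx : xx ∈ (univ : Finset (Fin 12)) \ {xx, z} := by rw [h]; exact mem_univ _
      simp at hx
    · rw [sdiff_sdiff_right_self, inf_eq_inter, univ_inter]

/-- At the roots `x` and `y` the rooted pair has no bad block. [this work] -/
theorem badBlocks_rooted_eq_empty {z : Fin 12} (hz : z = xx ∨ z = yy) :
    badBlocks (rooted z famU) (rooted z famV) = ∅ := by
  ext B'
  unfold badBlocks
  rw [mem_filter, doublyBad_rooted_iff]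
  simp only [mem_univ, true_and, notMem_empty, iff_false, not_and]
  intro hlast _ h
  have hy : yy ∈ ({xx, yy} : Finset (Fin 12)).map (sw z) := by
    rw [mem_map]
    rcases hz with rfl | rfl
    · exact ⟨xx, mem_insert_self _ _, by rw [sw_apply, Equiv.swap_apply_left]⟩
    · exact ⟨yy, mem_insert_of_mem (mem_singleton_self _), by rw [sw_apply, Equiv.swap_apply_right]⟩
  rw [← h, mem_sdiff] at hy
  exact hy.2 hlast

/-- The bad block term at a root in the block: `9!·½·P_{xy}(½) = −9!/8`. [this work] -/
theorem blockTerm_rooted {z : Fin 12} (hz : z ∈ Bset) :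
    blockTerm (rooted z famU) (rooted z famV) (univ \ {xx, z}) (1 / 2) = -((Nat.factorial 9 : ℝ) * (1 / 8)) := by
  obtain ⟨hzx, hzy⟩ := (mem_Bset z).1 hz
  have hxz : xx ≠ z := fun h => hzx h.symm
  set B' : Finset (Fin 12) := univ \ {xx, z} with hB'
  have hB'u : B' ≠ univ := by
    intro h
    have hx : xx ∈ B' := by rw [h]; exact mem_univ _
    rw [hB', mem_sdiff] at hx
    simp at hx
  have hcard : B'.card = 10 := by rw [hB', card_sdiff_of_subset (subset_univ _), card_univ, Fintype.card_fin, card_pair hxz]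
  -- the relabelled block is `B`
  have hmapB : B'.map (sw z) = Bset := by
    ext q
    rw [mem_Bset, mem_map]
    constructor
    · rintro ⟨a, ha, rfl⟩
      rw [hB', mem_sdiff] at ha
      have ha' : a ≠ xx ∧ a ≠ z := by simpa using ha.2
      rw [sw_apply]
      by_cases hay : a = yy
      · rw [hay, Equiv.swap_apply_right]; exact ⟨hzx, hzy⟩
      · rw [Equiv.swap_apply_of_ne_of_ne ha'.2 hay]; exact ⟨ha'.1, hay⟩
    · rintro ⟨hqx, hqy⟩
      by_cases hqz : q = z
      · refine ⟨yy, ?_, ?_⟩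
        · rw [hB', mem_sdiff]; refine ⟨mem_univ _, ?_⟩; simp only [mem_insert, mem_singleton, not_or]
          exact ⟨fun h => xx_ne_yy h.symm, fun h => hzy h.symm⟩
        · rw [sw_apply, Equiv.swap_apply_right, hqz]
      · refine ⟨q, ?_, ?_⟩
        · rw [hB', mem_sdiff]; refine ⟨mem_univ _, ?_⟩; simp only [mem_insert, mem_singleton, not_or]; exact ⟨hqx, hqz⟩
        · rw [sw_apply, Equiv.swap_apply_of_ne_of_ne hqz hqy]
  -- the complementary factor is the edge polynomial on `{x, z}` relabelled, i.e. `Φ_2` of the crossing pair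
  obtain ⟨m, e, he, hsurj, hc⟩ := exists_emb_coRest' hB'u
  have hrange : (univ : Finset (Fin (m + 1))).map e = {xx, z} := by
    rw [map_univ_eq_sdiff e he hsurj, hB', sdiff_sdiff_right_self, inf_eq_inter, univ_inter]
  have hm : m = 1 := by
    have h := congrArg Finset.card hrange
    rw [card_map, card_univ, Fintype.card_fin, card_pair hxz] at h
    omega
  subst hm
  unfold blockTerm
  rw [hc, hcard, mix_rooted, hmapB, mix_half_pset pp_mem_Bset (subset_refl _), neg_neg, PrincipalCapBeta.phiSet_two]
  -- the three values of the relabelled mixture on `Fin 2`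
  have h01 : ∀ t : Fin 2, e t = xx ∨ e t = z := by
    intro t
    have : e t ∈ ({xx, z} : Finset (Fin 12)) := by rw [← hrange]; exact mem_map_of_mem e (mem_univ t)
    simpa using this
  have hval : ∀ t : Fin 2, mix (rooted z famU) (rooted z famV) (1 / 2) (({t} : Finset (Fin 2)).map e) = 1 / 2 := by
    intro t
    rw [mix_rooted, map_singleton, map_singleton, sw_apply]
    rcases h01 t with h | h
    · rw [h, Equiv.swap_apply_of_ne_of_ne hxz xx_ne_yy, mix_half_x]
    · rw [h, Equiv.swap_apply_left, mix_half_y]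
  have huniv : mix (rooted z famU) (rooted z famV) (1 / 2) ((univ : Finset (Fin 2)).map e) = 0 := by
    rw [mix_rooted, hrange, map_insert, map_singleton, sw_apply, sw_apply, Equiv.swap_apply_of_ne_of_ne hxz xx_ne_yy,
      Equiv.swap_apply_left, mix_half_xy]
  rw [huniv, hval 0, hval 1]
  norm_num

/-! ### The value of the (C̄) slack at `½` and the refutation -/

/-- The summand of `cbarSlack` at the root `z`, evaluated. [this work] -/
theorem summand_eq (z : Fin 12) :
    capW (rooted z famU) (rooted z famV) (1 / 2) +
        ∑ B ∈ badBlocks (rooted z famU) (rooted z famV), blockTerm (rooted z famU) (rooted z famV) B (1 / 2) =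
      if z = pp then -((Nat.factorial 9 : ℝ) * (1 / 8))
      else if z ∈ Bset then (Nat.factorial 8 : ℝ) * (5 / 8) - (Nat.factorial 9 : ℝ) * (1 / 8)
      else (Nat.factorial 9 : ℝ) * (1 / 4) := by
  rw [capW_rooted_eq_badOn]
  by_cases hzp : z = pp
  · subst hzp
    rw [if_pos rfl, W_pin, badBlocks_rooted_of_mem pp_mem_Bset, sum_singleton, blockTerm_rooted pp_mem_Bset]; ring
  · rw [if_neg hzp]
    by_cases hz : z ∈ Bset
    · rw [if_pos hz, W_block hz hzp, badBlocks_rooted_of_mem hz, sum_singleton, blockTerm_rooted hz]; ring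
    · rw [if_neg hz]
      have hz' : z = xx ∨ z = yy := by
        by_cases h : z = xx
        · exact Or.inl h
        · right; by_contra h'; exact hz ((mem_Bset z).2 ⟨h, h'⟩)
      rw [badBlocks_rooted_eq_empty hz', sum_empty, add_zero]
      rcases hz' with rfl | rfl
      · exact W_x
      · exact W_y

/-- **`cbarSlack famU famV (½) = −9!/8`.** [this work] -/
theorem cbarSlack_half : cbarSlack famU famV (1 / 2) = -45360 := by
  unfold cbarSlack
  rw [sum_congr rfl fun z _ => summand_eq z]
  -- split `univ = Bset ∪ {x, y}`, `Bset = insert p (Bset.erase p)`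
  have hsplit : (univ : Finset (Fin 12)) = Bset ∪ {xx, yy} := by decide
  have hdisj : Disjoint Bset ({xx, yy} : Finset (Fin 12)) := by decide
  rw [hsplit, sum_union hdisj, sum_pair xx_ne_yy, ← add_sum_erase Bset _ pp_mem_Bset]
  have hrest : ∑ z ∈ Bset.erase pp, (if z = pp then -((Nat.factorial 9 : ℝ) * (1 / 8))
      else if z ∈ Bset then (Nat.factorial 8 : ℝ) * (5 / 8) - (Nat.factorial 9 : ℝ) * (1 / 8) else (Nat.factorial 9 : ℝ) * (1 / 4)) =
      ∑ z ∈ Bset.erase pp, ((Nat.factorial 8 : ℝ) * (5 / 8) - (Nat.factorial 9 : ℝ) * (1 / 8)) := by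
    refine sum_congr rfl fun z hz => ?_
    obtain ⟨hzp, hzB⟩ := mem_erase.1 hz
    rw [if_neg hzp, if_pos hzB]
  have hcard : (Bset.erase pp).card = 9 := by decide
  have hx : ¬ (xx = pp) := fun h => pp_ne_xx h.symm
  have hy : ¬ (yy = pp) := fun h => pp_ne_yy h.symm
  have hxB : xx ∉ Bset := by decide
  have hyB : yy ∉ Bset := by decide
  rw [hrest, sum_const, hcard, if_pos rfl, if_neg hx, if_neg hxB, if_neg hy, if_neg hyB]
  simp only [nsmul_eq_mul, Nat.factorial]
  norm_num

/-- **THEOREM.  The root-summed criterion (C̄) is false: `¬ RootSummed.CBar 11`.** [this work] -/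
theorem not_CBar_eleven : ¬ CBar 11 := by
  intro h
  have hB := h famU famV famU_uc famV_uc univ_mem_famU univ_mem_famV
  have h0 : (0 : ℝ) ≤ cbarSlack famU famV (1 / 2) := hB.nonneg (by norm_num) (by norm_num)
  rw [cbarSlack_half] at h0
  norm_num at h0

end CBarRefutation

end Summit.CriticalPhenomena.PercolationContinuityZ3.Theorems
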